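import Summits.Ventures.PercRepro.Night2LocalThmEFinal

/-!
# PercRepro — the type `(2, 2)` of the `q = 3` case split: the pair scheme (night-2, gen 9)

At a rank-`4` flat `G` with `|E ∖ G| = 2` (so `q = 3`, `Φ = 5/4`, local demand `Φ·m/(m+2)`, `m = |G ∖ cl B|`) whose
members all have `m ≥ 2`, the fractional matching

  `w(B, B ∪ {z}) = 1/4` for every `z ∈ G ∖ cl B`  +  `w(B, B ∪ (G ∖ cl B)) = 1/8` when `m = 2`

certifies the local form: rows give `m/4 ≥ Φ·m/(m+2)` for `m ≥ 3` and `1/2 + 1/8 = 5/8 = Φ·2/4` for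
`m = 2`; the column of a shadow set `S` is `#coverPreimages/4 + #farPre/8`, where the far preimages
(`S = B ∪ (G ∖ cl B)`, `|G ∖ cl B| = 2`) inject into the series pairs of `S` via `B ↦ S ∖ B`, so with
`κ₀ = #coloops S`: `#coverPreimages ≤ κ₀` and `2·#farPre ≤ (5−κ₀)(4−κ₀)`, whence `2·#cover + #far ≤ 8`
for `κ₀ ≥ 1`.  For `κ₀ = 0` the count gives only `#farPre ≤ 10`; the theorem takes `#farPre ≤ 8` at coloop-free
shadow sets as its hypothesis (`hfar`) — on paper (NIGHT-2-local.md §19) at most `6` far preimages exist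
there (`≥ 9` member pairs force `G` to be five elements, where no member exists).
-/

namespace PercRepro.Shadow

open Finset PerFlat ThmH

variable {α : Type*} [DecidableEq α] {M : Matroid α} [M.Finite]

open scoped Classical in
/-- The far preimages of `S` at a flat `G`: the members `B` below `G` with `|G ∖ cl B| = 2` and
`S = B ∪ (G ∖ cl B)`. -/
noncomputable def farPre (M : Matroid α) [M.Finite] (q : ℕ) (G S : Finset α) : Finset (Finset α) :=
  (membersIn M (Uq M (q + 2) q) G).filter (fun B => (G \ clF M B).card = 2 ∧ S = B ∪ (G \ clF M B))

open scoped Classical in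
/-- Membership in `farPre`. -/
theorem mem_farPre {q : ℕ} {G S B : Finset α} :
    B ∈ farPre M q G S ↔ B ∈ membersIn M (Uq M (q + 2) q) G ∧ (G \ clF M B).card = 2 ∧ S = B ∪ (G \ clF M B) := by
  unfold farPre
  rw [Finset.mem_filter]

omit [DecidableEq α] in
/-- A flat of `flatsQ` contains its finset closure. -/
theorem clF_subset_self_of_mem_flatsQ {q : ℕ} {G : Finset α} (hG : G ∈ flatsQ M q) : clF M G ⊆ G := by
  rw [← Finset.coe_subset, coe_clF]
  exact (mem_flatsQ.1 hG).2.1.closure.le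

open scoped Classical in
/-- A far trace `B ∪ Z` (`Z ⊆ G ∖ cl B`, `|Z| = 2`) of a member is a shadow set with closure `G`. -/
theorem union_mem_shadowAt_of_far {q : ℕ} {G : Finset α} (hG : G ∈ flatsQ M (q + 1)) {B : Finset α}
    (hB : B ∈ membersIn M (Uq M (q + 2) q) G) {Z : Finset α} (hZ : Z ⊆ G \ clF M B) (hZne : Z.Nonempty) :
    B ∪ Z ∈ shadowAt M (q + 2) q (Uq M (q + 2) q) G := by
  obtain ⟨z, hz⟩ := hZne
  have h1 : insert z B ∈ shadowAt M (q + 2) q (Uq M (q + 2) q) G :=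
    insert_mem_shadowAt (Finset.Subset.refl _) hG hB (hZ hz)
  have hGg : G ⊆ gr M := (mem_flatsQ.1 hG).1
  have hsub1 : insert z B ⊆ B ∪ Z := by
    intro e he
    rw [Finset.mem_insert] at he
    rw [Finset.mem_union]
    rcases he with rfl | he
    · exact Or.inr hz
    · exact Or.inl he
  have hsub2 : B ∪ Z ⊆ G := by
    intro e he
    rw [Finset.mem_union] at he
    rcases he with he | he
    · exact (mem_membersIn.1 hB).2 (subset_clF (mem_membersIn.1 hB).1 he)
    · exact (Finset.mem_sdiff.1 (hZ he)).1
  rw [mem_shadowAt] at h1 ⊢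
  obtain ⟨h1s, h1c⟩ := h1
  rw [mem_shadow] at h1s ⊢
  obtain ⟨h1Y, B', hB', hB'S⟩ := h1s
  have hY : B ∪ Z ∈ Yq M (q + 2) q := by
    unfold Yq at h1Y ⊢
    rw [Finset.mem_filter, Finset.mem_powerset] at h1Y ⊢
    refine ⟨hsub2.trans hGg, ?_, ?_⟩
    · exact lt_of_lt_of_le h1Y.2.1 (M.eRk_mono (by exact_mod_cast hsub1))
    · calc M.eRk ((B ∪ Z : Finset α) : Set α) ≤ M.eRk (G : Set α) := M.eRk_mono (by exact_mod_cast hsub2)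
        _ = ((q + 1 : ℕ) : ℕ∞) := (mem_flatsQ.1 hG).2.2
        _ < ((q + 2 : ℕ) : ℕ∞) := by exact_mod_cast (by omega : q + 1 < q + 2)
  refine ⟨⟨hY, B', hB', hB'S.trans hsub1⟩, ?_⟩
  apply le_antisymm
  · exact (clF_mono hsub2).trans (clF_subset_self_of_mem_flatsQ hG)
  · rw [← h1c]
    exact clF_mono hsub1

open scoped Classical in
/-- A far preimage `B` of `S` gives the series pair `S ∖ B` of `S`. -/
theorem sdiff_mem_seriesPairs_of_farPre {q : ℕ} {G : Finset α} (hG : G ∈ flatsQ M (q + 1))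
    {S : Finset α} (hS : S ∈ shadowAt M (q + 2) q (Uq M (q + 2) q) G) {B : Finset α}
    (hB : B ∈ farPre M q G S) : S \ B ∈ seriesPairs M S q := by
  have hSG : S ⊆ G := subset_of_mem_shadowAt hS
  have hSE : S ⊆ gr M := hSG.trans (mem_flatsQ.1 hG).1
  have hSr : rkN M S = q + 1 := by
    unfold rkN; rw [eRk_eq_of_mem_Yq_diag (mem_shadow.1 (mem_shadowAt.1 hS).1).1]; rfl
  rw [mem_farPre] at hB
  obtain ⟨hBm, hcard2, hSeq⟩ := hB
  have hBU : B ∈ Uq M (q + 2) q := (mem_membersIn.1 hBm).1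
  have hBG : clF M B ⊆ G := (mem_membersIn.1 hBm).2
  have hBS : B ⊆ S := by rw [hSeq]; exact Finset.subset_union_left
  have hdisj : Disjoint B (G \ clF M B) :=
    Finset.disjoint_of_subset_left (subset_clF hBU) Finset.disjoint_sdiff
  have hSB : S \ B = G \ clF M B := by
    rw [hSeq, Finset.union_sdiff_cancel_left hdisj]
  have hsub : S \ B ⊆ G \ clF M B := hSB.le
  have hcard : (S \ B).card = 2 := by rw [hSB]; exact hcard2
  unfold seriesPairs
  rw [Finset.mem_filter, Finset.mem_powersetCard]
  refine ⟨⟨Finset.sdiff_subset, hcard⟩, ?_⟩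
  intro x hx y hy hxy
  have hxS : x ∈ S := (Finset.mem_sdiff.1 hx).1
  have hyS : y ∈ S := (Finset.mem_sdiff.1 hy).1
  have hBr : rkN M B = q := by
    unfold rkN; rw [(mem_Uq.1 hBU).2.1]; rfl
  have hnc : ∀ a b, a ∈ S \ B → b ∈ S \ B → a ≠ b → rkN M (S.erase a) = q + 1 := by
    intro a b ha hb hab
    have hbG : b ∈ G \ clF M B := hsub hb
    have hcl : clF M (insert b B) = G := clF_insert_eq_of_mem_sdiff hG hBU hBG hbG
    have hrk : rkN M (insert b B) = q + 1 := by
      unfold rkN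
      have : M.eRk ((insert b B : Finset α) : Set α) = M.eRk (G : Set α) := by
        rw [← M.eRk_closure_eq ((insert b B : Finset α) : Set α), ← coe_clF, hcl]
      rw [this, (mem_flatsQ.1 hG).2.2]; rfl
    have hsub' : insert b B ⊆ S.erase a := by
      intro e he
      rw [Finset.mem_insert] at he
      rw [Finset.mem_erase]
      rcases he with rfl | he
      · exact ⟨fun h => hab h.symm, (Finset.mem_sdiff.1 hb).1⟩
      · exact ⟨fun h => (Finset.mem_sdiff.1 ha).2 (h ▸ he), hBS he⟩
    have h1 := rkN_mono (M := M) hsub'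
    have h2 := rkN_mono (M := M) (Finset.erase_subset a S)
    rw [hrk] at h1; rw [hSr] at h2
    omega
  refine ⟨hxS, hyS, hxy, hnc x y hx hy hxy, hnc y x hy hx hxy.symm, ?_⟩
  have hpair : S \ {x, y} = B := by
    have hP : S \ B = {x, y} := by
      obtain ⟨x', y', hxy', hP⟩ := Finset.card_eq_two.1 hcard
      rw [hP] at hx hy ⊢
      rw [Finset.mem_insert, Finset.mem_singleton] at hx hy
      rcases hx with rfl | rfl <;> rcases hy with rfl | rfl
      · exact absurd rfl hxy
      · rfl
      · exact Finset.pair_comm _ _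
      · exact absurd rfl hxy
    rw [← hP, Finset.sdiff_sdiff_eq_self hBS]
  rw [hpair, hBr]

open scoped Classical in
/-- The far preimages inject into the series pairs: `#farPre S ≤ #seriesPairs S`. -/
theorem card_farPre_le_card_seriesPairs {q : ℕ} {G : Finset α} (hG : G ∈ flatsQ M (q + 1))
    {S : Finset α} (hS : S ∈ shadowAt M (q + 2) q (Uq M (q + 2) q) G) :
    (farPre M q G S).card ≤ (seriesPairs M S q).card := by
  apply Finset.card_le_card_of_injOn (fun B => S \ B)
  · intro B hB
    exact sdiff_mem_seriesPairs_of_farPre hG hS (by exact_mod_cast hB)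
  · intro B hB B' hB' hBB'
    have h1 : B ⊆ S := by
      rw [Finset.mem_coe, mem_farPre] at hB
      rw [hB.2.2]; exact Finset.subset_union_left
    have h2 : B' ⊆ S := by
      rw [Finset.mem_coe, mem_farPre] at hB'
      rw [hB'.2.2]; exact Finset.subset_union_left
    have h3 : S \ B = S \ B' := hBB'
    calc B = S \ (S \ B) := (Finset.sdiff_sdiff_eq_self h1).symm
      _ = S \ (S \ B') := by rw [h3]
      _ = B' := Finset.sdiff_sdiff_eq_self h2

open scoped Classical in
/-- `2 · #farPre S ≤ (q+2−κ₀)(q+1−κ₀)` at every shadow set. -/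
theorem two_mul_card_farPre_le {q : ℕ} {G : Finset α} (hG : G ∈ flatsQ M (q + 1))
    {S : Finset α} (hS : S ∈ shadowAt M (q + 2) q (Uq M (q + 2) q) G) :
    2 * (farPre M q G S).card ≤ (q + 2 - (coloops M S).card) * (q + 1 - (coloops M S).card) := by
  have hSG : S ⊆ G := subset_of_mem_shadowAt hS
  have hSE : S ⊆ gr M := hSG.trans (mem_flatsQ.1 hG).1
  have hSr : rkN M S = q + 1 := by
    unfold rkN; rw [eRk_eq_of_mem_Yq_diag (mem_shadow.1 (mem_shadowAt.1 hS).1).1]; rfl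
  have h1 := card_farPre_le_card_seriesPairs hG hS
  have h2 := two_mul_card_seriesPairs_le hSE hSr
  omega

/-! ## The pair scheme at `q = 3`, `|E ∖ G| = 2` -/

open scoped Classical in
/-- The weight of the pair scheme. -/
theorem pairScheme_row {G : Finset α} (hG : G ∈ flatsQ M 4) (hd : (gr M \ G).card = 2) {B : Finset α}
    (hB : B ∈ membersIn M (Uq M 5 3) G) (h2 : 2 ≤ (G \ clF M B).card) :
    (((3 : ℕ) : ℚ) + 2) / (((3 : ℕ) : ℚ) + 1) * localWeight M B G ≤
      ∑ S ∈ shadowAt M 5 3 (Uq M 5 3) G,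
        ((if S ∈ coverSets M B G then (1 : ℚ) / 4 else 0) +
          (if (G \ clF M B).card = 2 ∧ S = B ∪ (G \ clF M B) then (1 : ℚ) / 8 else 0)) := by
  have hBU : B ∈ Uq M 5 3 := (mem_membersIn.1 hB).1
  have hBG : clF M B ⊆ G := (mem_membersIn.1 hB).2
  have hadd := card_compl_clF_add hG hBG
  rw [hd] at hadd
  rw [Finset.sum_add_distrib]
  -- covering part
  have hcov : ∑ S ∈ shadowAt M 5 3 (Uq M 5 3) G, (if S ∈ coverSets M B G then (1 : ℚ) / 4 else 0) =
      ((G \ clF M B).card : ℚ) / 4 := by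
    have hsub : coverSets M B G ⊆ shadowAt M 5 3 (Uq M 5 3) G :=
      coverSets_subset_shadowAt (Finset.Subset.refl _) hG hB
    rw [← Finset.sum_filter, Finset.filter_mem_eq_inter, Finset.inter_eq_right.2 hsub, Finset.sum_const,
      card_coverSets hBU, nsmul_eq_mul]
    ring
  -- far part
  have hfar : ∑ S ∈ shadowAt M 5 3 (Uq M 5 3) G,
      (if (G \ clF M B).card = 2 ∧ S = B ∪ (G \ clF M B) then (1 : ℚ) / 8 else 0) =
      if (G \ clF M B).card = 2 then (1 : ℚ) / 8 else 0 := by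
    by_cases hm : (G \ clF M B).card = 2
    · have hmem : B ∪ (G \ clF M B) ∈ shadowAt M 5 3 (Uq M 5 3) G :=
        union_mem_shadowAt_of_far hG hB (Finset.Subset.refl _)
          (Finset.card_pos.1 (by omega))
      rw [if_pos hm, ← Finset.sum_filter]
      have hfilt : (shadowAt M 5 3 (Uq M 5 3) G).filter
          (fun S => (G \ clF M B).card = 2 ∧ S = B ∪ (G \ clF M B)) = {B ∪ (G \ clF M B)} := by
        ext S
        rw [Finset.mem_filter, Finset.mem_singleton]
        constructor
        · rintro ⟨-, -, rfl⟩; rfl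
        · rintro rfl; exact ⟨hmem, hm, rfl⟩
      rw [hfilt, Finset.sum_singleton]
    · rw [if_neg hm]
      apply Finset.sum_eq_zero
      intro S _
      rw [if_neg]
      rintro ⟨h, -⟩
      exact hm h
  rw [hcov, hfar]
  unfold localWeight
  rw [hadd]
  push_cast
  set m : ℚ := ((G \ clF M B).card : ℚ) with hmdef
  have hm2 : (2 : ℚ) ≤ m := by rw [hmdef]; exact_mod_cast h2
  by_cases hm : (G \ clF M B).card = 2
  · rw [if_pos hm]
    have : m = 2 := by rw [hmdef, hm]; norm_num
    rw [this]; norm_num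
  · rw [if_neg hm]
    have hm3 : (3 : ℚ) ≤ m := by
      have : 3 ≤ (G \ clF M B).card := by omega
      rw [hmdef]; exact_mod_cast this
    rw [add_zero, div_mul_div_comm, div_le_div_iff₀ (by positivity) (by positivity)]
    nlinarith

open scoped Classical in
/-- The column of the pair scheme: `#coverPreimages/4 + #farPre/8`. -/
theorem pairScheme_col (G S : Finset α) :
    ∑ B ∈ membersIn M (Uq M 5 3) G,
        ((if S ∈ coverSets M B G then (1 : ℚ) / 4 else 0) +
          (if (G \ clF M B).card = 2 ∧ S = B ∪ (G \ clF M B) then (1 : ℚ) / 8 else 0)) =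
      ((coverPreimages M (Uq M 5 3) G S).card : ℚ) / 4 + ((farPre M 3 G S).card : ℚ) / 8 := by
  rw [Finset.sum_add_distrib]
  congr 1
  · unfold coverPreimages
    rw [← Finset.sum_filter, Finset.sum_const, nsmul_eq_mul]; ring
  · unfold farPre
    rw [← Finset.sum_filter, Finset.sum_const, nsmul_eq_mul]; ring

open scoped Classical in
/-- **The type `(2, 2)` at `q = 3` modulo the coloop-free far count**: at a rank-`4` flat `G` with `|E ∖ G| = 2`
whose members all have `|G ∖ cl B| ≥ 2`, if every coloop-free shadow set has at most `8` far preimages, the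
local form holds (the pair scheme). -/
theorem localShadowHall_two_two_of_far {G : Finset α} (hG : G ∈ flatsQ M 4) (hd : (gr M \ G).card = 2)
    (hno : ∀ B ∈ membersIn M (Uq M 5 3) G, 2 ≤ (G \ clF M B).card)
    (hfar : ∀ S ∈ shadowAt M 5 3 (Uq M 5 3) G, (coloops M S).card = 0 → (farPre M 3 G S).card ≤ 8) :
    LocalShadowHall M 3 G := by
  apply localShadowHall_of_full_matching (fun B S =>
    (if S ∈ coverSets M B G then (1 : ℚ) / 4 else 0) +
      (if (G \ clF M B).card = 2 ∧ S = B ∪ (G \ clF M B) then (1 : ℚ) / 8 else 0))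
  · intro B S
    apply add_nonneg <;> split_ifs <;> norm_num
  · intro B S h
    by_contra hBS
    apply h
    have h1 : (if S ∈ coverSets M B G then (1 : ℚ) / 4 else 0) = 0 := by
      rw [if_neg]
      intro hS
      obtain ⟨z, -, rfl⟩ := mem_coverSets.1 hS
      exact hBS (Finset.subset_insert _ _)
    have h2 : (if (G \ clF M B).card = 2 ∧ S = B ∪ (G \ clF M B) then (1 : ℚ) / 8 else 0) = 0 := by
      rw [if_neg]
      rintro ⟨-, rfl⟩
      exact hBS Finset.subset_union_left
    rw [h1, h2, add_zero]
  · intro S hS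
    rw [pairScheme_col]
    have hc : (coverPreimages M (Uq M 5 3) G S).card ≤ (coloops M S).card :=
      card_coverPreimages_le_card_coloops (Finset.Subset.refl _) G S
    have hf := two_mul_card_farPre_le hG hS
    have hk : (coloops M S).card ≤ 4 := by
      have hSG : S ⊆ G := subset_of_mem_shadowAt hS
      have hSE : S ⊆ gr M := hSG.trans (mem_flatsQ.1 hG).1
      exact card_coloops_le hSE (eRk_eq_of_mem_Yq_diag (mem_shadow.1 (mem_shadowAt.1 hS).1).1)
    -- `2·#cover + #far ≤ 8`
    have key : 2 * (coverPreimages M (Uq M 5 3) G S).card + (farPre M 3 G S).card ≤ 8 := by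
      rcases Nat.eq_zero_or_pos (coloops M S).card with h0 | hpos
      · have := hfar S hS h0
        omega
      · have : (coloops M S).card = 1 ∨ (coloops M S).card = 2 ∨ (coloops M S).card = 3 ∨
            (coloops M S).card = 4 := by omega
        rcases this with h | h | h | h <;> rw [h] at hf hc <;> omega
    have key' : (2 * (coverPreimages M (Uq M 5 3) G S).card + (farPre M 3 G S).card : ℚ) ≤ 8 := by
      exact_mod_cast key
    linarith
  · intro B hB
    exact pairScheme_row hG hd hB (hno B hB)

end PercRepro.Shadow
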